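import Summits.PneNP.PneNP.Theorems.SymmetryBudgetWindowBarrierEntropyGameTransfer

/-!
# Transfer lemma: comparison with canonical runs (refine / section / individualise)

Route `PneNP/SymmetryBudget`, dichotomy `WindowBarrier` (stmt-PneNP-2145) / `NoHiddenOrder` (stmt-PneNP-14781);
companion of `…EntropyGameTransfer.lean` and `…EntropyGameTransferClosure.lean`.

A canonical canonisation run (Corneil–Goldberg: equitable refinement, splitting along SOME sections, individualising
the chosen points `v₀, v₁, …` in order) only ever applies two kinds of events to its global partition `G`:
* a REFINEMENT-TYPE event `G ↦ G'` with `R G ≤ G' ≤ G` (one refinement round, or a split along some of the sections —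
  anything the full closure `R` dominates), and
* the INDIVIDUALISATION of the next point, `G ↦ G ⊓ sep v_j`.

`Refinement.Reach ρ v j G` is the inductive predicate "G is reachable by such events after the first `j` points".
`Refinement.path_le_of_reach`: the point path of the transfer lemma stays below every reachable state, `P_j ≤ G`.
Consequences: the class of `v_j` in `P_j` lies inside its class in the run's state (`rel_of_reach`, so the entropy
bound of `exists_colouring_transfer` is governed by the run's cells), and a run that ends discrete forces `P_t = ⊥`
(`path_eq_bot_of_reach_bot`), whence ONE conflict-free colouring `c` with `R (ker c) = ⊥`
(`exists_conflictFree_of_reach_bot`, with `…Transfer`'s greedy colouring).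
-/

-- `Summit.PneNP.PneNP.…` duplicates `PneNP` BY DESIGN (single-problem summit, D-0017).
set_option linter.dupNamespace false

namespace Summit.PneNP.PneNP.Theorems.CosetGame

namespace Refinement

variable {α : Type*} (ρ : Refinement α) (v : ℕ → α)

/-- **States reachable by a canonical run** after individualising the first `j` points of `v`: start at `⊤`;
refinement-type events move from `G` to any `G'` with `R G ≤ G' ≤ G`; the `j`-th individualisation meets with
`sep v_j`. -/
inductive Reach : ℕ → Setoid α → Prop
  | top : Reach 0 ⊤
  | refine {j : ℕ} {G G' : Setoid α} : Reach j G → G' ≤ G → ρ.R G ≤ G' → Reach j G'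
  | point {j : ℕ} {G : Setoid α} : Reach j G → Reach (j + 1) (G ⊓ sepSetoid (v j))

variable {ρ v}

/-- **Comparison.** The transfer path stays below every reachable state: `P_j ≤ G`. -/
theorem path_le_of_reach {j : ℕ} {G : Setoid α} (h : ρ.Reach v j G) : ρ.path v j ≤ G := by
  induction h with
  | top => exact ρ.le_self ⊤
  | @refine j G G' _ _ hRG ih =>
    calc ρ.path v j = ρ.R (ρ.path v j) := (ρ.R_path v j).symm
      _ ≤ ρ.R G := ρ.mono ih
      _ ≤ G' := hRG
  | @point j G _ ih =>
    calc ρ.path v (j + 1) = ρ.R (ρ.path v j ⊓ sepSetoid (v j)) := rfl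
      _ ≤ ρ.path v j ⊓ sepSetoid (v j) := ρ.le_self _
      _ ≤ G ⊓ sepSetoid (v j) := inf_le_inf_right _ ih

/-- The `P_j`-class of any point lies inside its class in the run's state. -/
theorem rel_of_reach {j : ℕ} {G : Setoid α} (h : ρ.Reach v j G) {x y : α} (hxy : ρ.path v j x y) : G x y :=
  path_le_of_reach h hxy

/-- A run that reaches the discrete partition forces the transfer path to be discrete. -/
theorem path_eq_bot_of_reach_bot {t : ℕ} (h : ρ.Reach v t ⊥) : ρ.path v t = ⊥ :=
  le_bot_iff.1 (path_le_of_reach h)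

/-- **One colouring for the whole run.** If a canonical run individualising the distinct points `v₀,…,v_{t-1}`
(in this order, with arbitrary refinement-type events in between) ends discrete, then the reverse greedy colouring
`c` of these points is conflict-free and `R (ker c) = ⊥`: refining the colouring alone, with no individualisation,
reaches the discrete partition. (Entropy: `…TransferGroup.exists_colouring_transfer`; classes bounded by the run's
cells via `rel_of_reach`.) -/
theorem R_ker_greedyColouring_eq_bot {t : ℕ} (h : ρ.Reach v t ⊥)
    (hinj : ∀ i j, i < t → j < t → v i = v j → i = j) :
    ρ.R (Setoid.ker (ρ.greedyColouring v t)) = ⊥ :=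
  ρ.R_ker_eq_bot_of_conflictFree (ρ.conflictFree_greedyColouring hinj) (path_eq_bot_of_reach_bot h)

/-- Reachability is monotone in the state for refinement-type moves: from a reachable `G`, the closure `R G` is
reachable (the "refine to stability / split by all sections" event). -/
theorem Reach.R {j : ℕ} {G : Setoid α} (h : ρ.Reach v j G) : ρ.Reach v j (ρ.R G) :=
  h.refine (ρ.le_self G) le_rfl

/-- The transfer path itself is reachable (the run "individualise, then close" realises it). -/
theorem reach_path : ∀ j : ℕ, ρ.Reach v j (ρ.path v j)
  | 0 => Reach.top.R
  | j + 1 => (reach_path j).point.R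

end Refinement

end Summit.PneNP.PneNP.Theorems.CosetGame
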